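import Summits.QuantumFields.BalabanUV.Beta.BlockMeanChartK1Row
import Summits.QuantumFields.BalabanUV.Beta.NVertexSectorsPeriodised
import Summits.QuantumFields.BalabanUV.Beta.FP.TowerDoorUniformDataCorrector

/-!
# `BalabanUV.Beta.FP.TowerDoorUniformDataColumn` — binder row D1, the row's ONE file, LEMMA U (J-NOTE-19 §4 U1, J-NOTE-20 §6), THIRD TYPED PIECE — THE KERNEL JUNCTION:
# **THE COMPOSITE ONE-SHOT CHART's FIELD–MULTIPLIER COLUMN IS `Ψ̂ (Π_bm (ℋ-column))` AT THE RECORD's LETTERS** —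
# `AN R j x (L•z) (inl α) (inr μ) = (Ψ_{j+1} (Π^{s}_bm (ℋ_μ(· − L•z))))_α(x)`, `L = Lc^(j+1)` — and, by the chart's block covariance, the SOURCE-SUMMED column (the response to UNIFORM
# data `e_μ`) is the `L`-periodisation of the ONE form `x ↦ (Ψ̂ (Π_bm ℋ_μ))_α(x)`; and, pushing the source sum through the two LOCAL linear maps (each output bond reads finitely many
# input bonds), **U1 AT THE KERNEL LETTER: `Σ_z AN R j x (L•z) (inl α) (inr μ) = (Π^{s}_bm (L^{−(d+2)}·e_μ))_α(x)` — the one-shot chart's response to UNIFORM data is the block comb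
# representative of the constant connection, `L^{−(d+1)}` on the `μ`-bonds crossing an `L`-face and `0` elsewhere, for EVERY root data** (lit affine reproduction + tree `axProjBmAt_const` + PART 50)
# (β-function cell `pub-balaban`, BINDER-OWNERS row D1 ∕ (C1) OWNER «beta-an2» gen 76, PART 51; imports PART 50)

WHY (located; J-NOTE-20 §6: LEMMA U ⟸ «the one-shot chart's response to uniform data has vanishing nested-comb rows»; tree: `GaugeMultiplierBlockMean.axProjBmAt_dz` ∕ `GAN24.PiBmConstants.axProjBmAt_const`
(`Π^ρ_bm (κ ↦ c κ) = N·c·𝟙{faces}`, any root); PART 50: `Ψ_m` fixes that field; lit `KernelSpecInstance.lowMomentsSum_specK`: `Σ_y ℋ_{κμ}(x − N•y) = δ_{κμ}∕N^(d+2)`).  The missing junction is the KERNEL-TO-FORM identity of this file: `AN = Ψ̂ ∘ (Π_bmᵀ K Π_bm) ∘ Ψ̂ᵀ`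
(`CompositeCorrectorDress.compChart`); on a field–multiplier entry the right `Ψ̂ᵀ` is the identity (`comp_trK_psiK_inr`), the left `Ψ̂` acts on the column by the corrector MAP (`comp_psiK_inl`, the «apply bridge»,
no hypothesis on the kernel), the co-dressed column is `Π^s_bm` of the straight column (GAN24 `colH_coDressKBmAt_eq_axProjBmAt`), and the straight column is `ℋ_μ(· − L•z)` (lit `KInv_inl_inr_coarse`,
`BlockMeanChartK1Row.colH_KInv_eq_Hcol`).  Block covariance (`NVertexSectorsPeriodised.AN_translate_invariant`) then moves the source to `0` at the price of translating `x`.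

WHAT ([folklore] re-writing BY NAME; no `def`, no `def … : Prop`, nothing cited, 0 sorry; `d = 3`, ANY root data `R : Roots Lc`, any door index `j`):
§1 **`AN_inl_inr_smul_eq_corrPsi_axProjBmAt`** — the display above; `AN_inl_inr_zero_eq` (source `0`);
§2 **`AN_inl_inr_smul_eq_translate`** (`AN R j x (L•z) (inl α) (inr μ) = AN R j (x − L•z) 0 (inl α) (inr μ)`), hence **`AN_inl_inr_smul_eq_corrPsi_axProjBmAt_zero`**: every source's column is the
translate of the ONE form `(Ψ̂ (Π_bm ℋ_μ))_α`, read at `x − L•z` — the source sum of LEMMA U is that form's `L`-periodisation.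
§3 pushing a pointwise-convergent family of 1-forms through the local maps: `hasSum_corrPsi_apply` (`Ψ_m`: `corrPsi_apply_eq_sum` over a finite read set), `hasSum_coProjBmW_apply` (the windowed `Π_bm`),
`hasSum_Hcol_translate` (lit `lowMomentsSum_specK`: `Σ_z ℋ_μ(w − L•z)_κ = δ_{κμ}·L^{−(d+2)}`); **`hasSum_AN_inl_inr_sources`**: `HasSum (z ↦ AN R j x (L•z) (inl α) (inr μ)) ((Π^{s}_bm (κ ↦ δ_{κμ}·L^{−(d+2)}))_α(x))`
(through `Ψ̂` by PART 50 `corrPsi_axProjBmAt_const`), and the face read-out **`tsum_AN_inl_inr_sources_eq`**: `Σ'_z … = if x_α % L = L − 1 then L·δ_{αμ}·L^{−(d+2)} else 0` (tree `axProjBmAt_const_apply`).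
WHAT THIS IS NOT: not U2 (the NESTED combs' rows of this field — zero, (P-b)-class), not LEMMA U (`hΘ`); the door NOT defined; nothing of
Bałaban's asserted, valued or discharged; 0 estimates; 0∕4 row-D1 binders (hW, hR, D1Tel, D1Rep); v10 NOT filed; v9 p617999 stands; NOT (C1), NOT (T-ID), NOT D1, NEVER «G-an2-4 closed», NOT BetaPertH, NOT continuum, NOT Clay.

HONEST DEPENDENCY (page 1, mandatory): continuum YM on T⁴ ⇐ BetaPertH ∧ nine spine estimates (0/9 proved); BetaPertH ⇐ (D1) ∧ (D4) ∧ CAP+tail;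
G-an2-4 gates asym, D1 and NE2/3/4.  HONEST FRAMING (cell contract, verbatim): «discharging `BetaPertH` makes Bałaban's UV stability UNCONDITIONAL —
a real constructive-QFT result; it is NOT the continuum limit and NOT the Clay problem.»  ABSOLUTE RULE (cell charter, verbatim): «No internally-minted
statement may enter as a cited fact. Every hypothesis is either kernel-proved in this package or a verbatim quotation of a PUBLISHED theorem with page
reference. The manuscript(s) under audit are NOT citable for their own disputed steps — they are the thing under adjudication; programme-internal
(2001/route/tribunal) claims are never citable.»  Row D1 ∕ (C1) OWNER «beta-an2» gen 76, 2026-08-29.  No existing file touched.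
-/

noncomputable section

open Finset
open scoped BigOperators
open Literature.MathematicalPhysics.QuantumFieldTheory
open Literature.MathematicalPhysics.QuantumFieldTheory.Balaban1983to89
open Literature.MathematicalPhysics.QuantumFieldTheory.Balaban1983to89.Beta
open B4TorusKernel.MultiPeriod (translate)
open AffineAveraging (Site toSite)
open OneStepResolventKernel (Fib KInv)
open OneStepKernelFamily (colH)
open ResolventComposition (Hcol)
open Summit.QuantumFields.BalabanUV.Beta.AxialDressingRooted (coDressKBmAt one_le_of_neZero)
open Summit.QuantumFields.BalabanUV.Beta.AxialProjectorBlockMean (axProjBmAt)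
open Summit.QuantumFields.BalabanUV.Beta.CompositeCorrectorForms (corrPsi)
open Summit.QuantumFields.BalabanUV.Beta.CompositeCorrectorKernel (psiK comp_psiK_inl comp_trK_psiK_inr)
open Summit.QuantumFields.BalabanUV.Beta.CompositeCorrectorDress (compChart)
open Summit.QuantumFields.BalabanUV.Beta.CompositeOneShotJetData (Roots AN AN_eq)
open Summit.QuantumFields.BalabanUV.Beta.NVertexSectorsPeriodised (AN_translate_invariant)
open Summit.QuantumFields.BalabanUV.Beta.BlockMeanChartK1Row (colH_KInv_eq_Hcol)
open Summit.QuantumFields.BalabanUV.Beta.GAN24.AxProjBmWindow (colH_coDressKBmAt_eq_axProjBmAt axProjBmAt_eq_coProjBmW')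
open Summit.QuantumFields.BalabanUV.Beta.AxialDressingRooted (coProjBmW coProjBmW_apply)
open Summit.QuantumFields.BalabanUV.Beta.CompositeCorrectorKernel (indR exists_finset_corrReads corrPsi_apply_eq_sum)
open Summit.QuantumFields.BalabanUV.Beta.GAN24.PiBmConstants (axProjBmAt_const_apply)
open Summit.QuantumFields.BalabanUV.Beta.FP.TowerDoorUniformDataCorrector (corrPsi_axProjBmAt_const)
open KernelSpecInstance (wH lowMomentsSum_specK)
open KernelRepresentationSummable (constReproSum_iff_decimated)
open AffineAveraging (Form1)

namespace Summit.QuantumFields.BalabanUV.Beta.FP.TowerDoorUniformDataColumn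

variable {Lc : ℕ} [NeZero Lc] (R : Roots Lc) (j : ℕ)

/-! ## §1 The chart's field–multiplier column is `Ψ̂ (Π_bm (ℋ-column))` -/

/-- [folklore] **`AN_inl_inr_smul_eq_corrPsi_axProjBmAt` — THE KERNEL JUNCTION OF LEMMA U**: for every root data `R`, door index `j`, fine bond `(α, x)` and coarse source
`(μ, z)` (`L = Lc^(j+1)`), `AN R j x (L•z) (inl α) (inr μ) = (Ψ_{j+1} (Π^{s_{j+1}}_bm (ℋ_μ(· − L•z))))_α(x)`
(`compChart` unfolded; `comp_trK_psiK_inr`; the apply bridge `comp_psiK_inl`; GAN24 `colH_coDressKBmAt_eq_axProjBmAt`; `colH_KInv_eq_Hcol`). -/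
theorem AN_inl_inr_smul_eq_corrPsi_axProjBmAt (x z : Site (3 + 1)) (α μ : Fin (3 + 1)) :
    AN R j x (((Lc ^ (j + 1) : ℕ) : ℤ) • z) (Sum.inl α) (Sum.inr μ)
      = corrPsi R.rc Lc (j + 1) (axProjBmAt (toSite (R.s (j + 1))) (Lc ^ (j + 1)) (Hcol (N := Lc ^ (j + 1)) μ z)) α x := by
  rw [AN_eq]
  unfold CompositeCorrectorDress.compChart
  rw [comp_trK_psiK_inr, comp_psiK_inl (Nat.pos_of_ne_zero (NeZero.ne Lc)) R.hrc (j + 1)]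
  have h := colH_coDressKBmAt_eq_axProjBmAt (one_le_of_neZero (Lc ^ (j + 1))) (R.hs (j + 1)) (KInv (N := Lc ^ (j + 1)) (d := 3)) μ z
  rw [colH_KInv_eq_Hcol] at h
  have e : (fun (κ : Fin (3 + 1)) (y : Site (3 + 1)) =>
      coDressKBmAt (toSite (R.s (j + 1))) (Lc ^ (j + 1)) (KInv (N := Lc ^ (j + 1)) (d := 3)) y (((Lc ^ (j + 1) : ℕ) : ℤ) • z) (Sum.inl κ) (Sum.inr μ))
      = colH (coDressKBmAt (toSite (R.s (j + 1))) (Lc ^ (j + 1)) (KInv (N := Lc ^ (j + 1)) (d := 3))) (Lc ^ (j + 1)) μ z := by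
    funext κ y; rfl
  rw [e, h]

/-- [folklore] … at the source `z = 0`: `AN R j x 0 (inl α) (inr μ) = (Ψ_{j+1} (Π_bm ℋ_μ))_α(x)` with `ℋ_μ = Hcol μ 0 = (κ, w) ↦ wH κ μ w`. -/
theorem AN_inl_inr_zero_eq (x : Site (3 + 1)) (α μ : Fin (3 + 1)) :
    AN R j x 0 (Sum.inl α) (Sum.inr μ)
      = corrPsi R.rc Lc (j + 1) (axProjBmAt (toSite (R.s (j + 1))) (Lc ^ (j + 1)) (Hcol (N := Lc ^ (j + 1)) μ 0)) α x := by
  have h := AN_inl_inr_smul_eq_corrPsi_axProjBmAt R j x 0 α μ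
  rwa [smul_zero] at h

/-! ## §2 Block covariance: every source's column is the translate of one form -/

/-- [folklore] **`AN_inl_inr_smul_eq_translate`** — the chart's column sourced at `L•z` is the column sourced at `0` read at `x − L•z` (`AN_translate_invariant` with the constant
box `L`, translate `−z`). -/
theorem AN_inl_inr_smul_eq_translate (x z : Site (3 + 1)) (α μ : Fin (3 + 1)) :
    AN R j x (((Lc ^ (j + 1) : ℕ) : ℤ) • z) (Sum.inl α) (Sum.inr μ)
      = AN R j (x - ((Lc ^ (j + 1) : ℕ) : ℤ) • z) 0 (Sum.inl α) (Sum.inr μ) := by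
  have h := AN_translate_invariant R j (M := fun _ : Fin (3 + 1) => Lc ^ (j + 1)) (fun _ => dvd_rfl) (-z)
    x (((Lc ^ (j + 1) : ℕ) : ℤ) • z) (Sum.inl α) (Sum.inr μ)
  have e1 : translate (fun _ : Fin (3 + 1) => Lc ^ (j + 1)) x (-z) = x - ((Lc ^ (j + 1) : ℕ) : ℤ) • z := by
    funext i; simp only [B4TorusKernel.MultiPeriod.translate_apply, Pi.sub_apply, Pi.smul_apply, Pi.neg_apply, smul_eq_mul]; ring
  have e2 : translate (fun _ : Fin (3 + 1) => Lc ^ (j + 1)) (((Lc ^ (j + 1) : ℕ) : ℤ) • z) (-z) = 0 := by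
    funext i; simp only [B4TorusKernel.MultiPeriod.translate_apply, Pi.smul_apply, Pi.neg_apply, smul_eq_mul, Pi.zero_apply]; ring
  rw [e1, e2] at h
  exact h.symm

/-- [folklore] **`AN_inl_inr_smul_eq_corrPsi_axProjBmAt_zero`** — hence every source's column is the translate of the ONE form `(Ψ_{j+1} (Π_bm ℋ_μ))_α`:
`AN R j x (L•z) (inl α) (inr μ) = (Ψ_{j+1} (Π_bm (Hcol μ 0)))_α (x − L•z)` — the source sum of LEMMA U is this form's `L`-periodisation. -/
theorem AN_inl_inr_smul_eq_corrPsi_axProjBmAt_zero (x z : Site (3 + 1)) (α μ : Fin (3 + 1)) :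
    AN R j x (((Lc ^ (j + 1) : ℕ) : ℤ) • z) (Sum.inl α) (Sum.inr μ)
      = corrPsi R.rc Lc (j + 1) (axProjBmAt (toSite (R.s (j + 1))) (Lc ^ (j + 1)) (Hcol (N := Lc ^ (j + 1)) μ 0)) α
          (x - ((Lc ^ (j + 1) : ℕ) : ℤ) • z) := by
  rw [AN_inl_inr_smul_eq_translate, AN_inl_inr_zero_eq]

/-! ## §3 The source sum pushed through the two local maps: U1 at the kernel letter -/

section Sources

variable {d' : ℕ}

/-- [folklore] **PUSHING A POINTWISE-CONVERGENT FAMILY THROUGH `Ψ_m` AT ONE OUTPUT BOND**: if every entry of the family `A i` has the sum `A∞`'s entry, then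
`(Ψ_m (A i))_α(x)` has the sum `(Ψ_m A∞)_α(x)` — `Ψ_m`'s component reads finitely many bonds linearly (`corrPsi_apply_eq_sum`). -/
theorem hasSum_corrPsi_apply {L : ℕ} (hL : 0 < L) {r : ℕ → (Fin (d' + 1) → ℕ)} (hr : ∀ k, r k ∈ AffineAveraging.box (d' + 1) L) (m : ℕ)
    {ι : Type*} {A : ι → Form1 (d' + 1) ℝ} {Ainf : Form1 (d' + 1) ℝ} (hA : ∀ κ y, HasSum (fun i => A i κ y) (Ainf κ y))
    (α : Fin (d' + 1)) (x : Site (d' + 1)) :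
    HasSum (fun i => corrPsi r L m (A i) α x) (corrPsi r L m Ainf α x) := by
  obtain ⟨S, hS⟩ := exists_finset_corrReads hL m α x
  have e : ∀ B : Form1 (d' + 1) ℝ, corrPsi r L m B α x = ∑ p ∈ S, corrPsi r L m (indR p.1 p.2) α x * B p.1 p.2 :=
    fun B => corrPsi_apply_eq_sum hL hr m α x hS B
  rw [show (fun i => corrPsi r L m (A i) α x) = fun i => ∑ p ∈ S, corrPsi r L m (indR p.1 p.2) α x * A i p.1 p.2 from
    funext fun i => e (A i), e Ainf]
  exact hasSum_sum fun p _ => (hA p.1 p.2).mul_left _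

/-- [folklore] **… AND THROUGH THE WINDOWED `Π_bm`** (`coProjBmW`: a finite window sum at each output bond). -/
theorem hasSum_coProjBmW_apply (ρ : Fin (d' + 1) → ℤ) (N : ℕ) {ι : Type*} {A : ι → Form1 (d' + 1) ℝ} {Ainf : Form1 (d' + 1) ℝ}
    (hA : ∀ κ y, HasSum (fun i => A i κ y) (Ainf κ y)) (κ' : Fin (d' + 1)) (u' : Site (d' + 1)) :
    HasSum (fun i => coProjBmW ρ N (A i) κ' u') (coProjBmW ρ N Ainf κ' u') := by
  simp only [coProjBmW_apply]
  exact hasSum_sum fun v _ => hasSum_sum fun κ _ => (hA κ (u' - v)).mul_left _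

/-- [folklore] **THE STRAIGHT COLUMNS SUM TO THE CONSTANT CONNECTION** (lit affine reproduction, `lowMomentsSum_specK` in the `y`-form): at every fine bond `(κ, w)`,
`Σ_z ℋ_μ(· − N•z)_κ(w) = Σ_z wH κ μ (w − N•z)` has the sum `δ_{κμ}·N^{−(d+2)}`. -/
theorem hasSum_Hcol_translate (N : ℕ) [NeZero N] (μ κ : Fin (d' + 1)) (w : Site (d' + 1)) :
    HasSum (fun z : Site (d' + 1) => Hcol (N := N) μ z κ w) (if κ = μ then (((N : ℝ) ^ (d' + 1 + 1))⁻¹) else 0) := by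
  have h := (constReproSum_iff_decimated (NeZero.ne N) (wH (N := N) κ μ) _).1 ((lowMomentsSum_specK (N := N) (d := d')).1 κ μ) w
  simpa only [ResolventComposition.Hcol_apply] using h

end Sources

section Uniform

/-- [folklore] **`hasSum_AN_inl_inr_sources` — U1 AT THE KERNEL LETTER: THE ONE-SHOT CHART's RESPONSE TO UNIFORM DATA IS THE COMB REPRESENTATIVE OF THE CONSTANT CONNECTION.**
For every root data `R`, door index `j` (`L = Lc^(j+1)`), fine bond `(α, x)` and direction `μ`:
`HasSum (z ↦ AN R j x (L•z) (inl α) (inr μ)) ((Π^{s_{j+1}}_bm (κ ↦ δ_{κμ}·L^{−(d+2)}))_α(x))`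
(§1 at every source; `Π_bm = coProjBmW` on the window, §3's two pushes over lit `lowMomentsSum_specK`; then PART 50 `corrPsi_axProjBmAt_const` removes `Ψ̂`). -/
theorem hasSum_AN_inl_inr_sources (x : Site (3 + 1)) (α μ : Fin (3 + 1)) :
    HasSum (fun z : Site (3 + 1) => AN R j x (((Lc ^ (j + 1) : ℕ) : ℤ) • z) (Sum.inl α) (Sum.inr μ))
      (axProjBmAt (toSite (R.s (j + 1))) (Lc ^ (j + 1)) (fun κ _ => if κ = μ then ((((Lc ^ (j + 1) : ℕ) : ℝ) ^ (3 + 1 + 1))⁻¹) else 0) α x) := by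
  have hL1 : 1 ≤ Lc ^ (j + 1) := one_le_of_neZero (Lc ^ (j + 1))
  have hLc : 0 < Lc := Nat.pos_of_ne_zero (NeZero.ne Lc)
  -- the family, source by source, through `Ψ̂ ∘ Π_bm` of the straight column
  have e : ∀ z : Site (3 + 1), AN R j x (((Lc ^ (j + 1) : ℕ) : ℤ) • z) (Sum.inl α) (Sum.inr μ)
      = corrPsi R.rc Lc (j + 1) (coProjBmW (toSite (R.s (j + 1))) (Lc ^ (j + 1)) (Hcol (N := Lc ^ (j + 1)) μ z)) α x := by
    intro z
    rw [AN_inl_inr_smul_eq_corrPsi_axProjBmAt, axProjBmAt_eq_coProjBmW' hL1 (R.hs (j + 1))]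
  simp_rw [e]
  -- the limit: `Ψ̂` fixes `Π_bm` of the constant connection (PART 50), and `Π_bm = coProjBmW`
  rw [← corrPsi_axProjBmAt_const hLc R.rc R.hrc (j + 1) (toSite (R.s (j + 1))), axProjBmAt_eq_coProjBmW' hL1 (R.hs (j + 1))]
  exact hasSum_corrPsi_apply hLc R.hrc (j + 1)
    (hasSum_coProjBmW_apply (toSite (R.s (j + 1))) (Lc ^ (j + 1)) (fun κ w => hasSum_Hcol_translate (Lc ^ (j + 1)) μ κ w)) α x

/-- [folklore] **`tsum_AN_inl_inr_sources_eq` — THE FACE READ-OUT**: `Σ'_z AN R j x (L•z) (inl α) (inr μ) = if x_α % L = L − 1 then L·(δ_{αμ}·L^{−(d+2)}) else 0` — `L^{−(d+1)}` on the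
`μ`-bonds crossing an `L`-face, zero elsewhere, WHATEVER THE ROOTS (tree `PiBmConstants.axProjBmAt_const_apply`). -/
theorem tsum_AN_inl_inr_sources_eq (x : Site (3 + 1)) (α μ : Fin (3 + 1)) :
    (∑' z : Site (3 + 1), AN R j x (((Lc ^ (j + 1) : ℕ) : ℤ) • z) (Sum.inl α) (Sum.inr μ))
      = if x α % ((Lc ^ (j + 1) : ℕ) : ℤ) = ((Lc ^ (j + 1) : ℕ) : ℤ) - 1
        then ((Lc ^ (j + 1) : ℕ) : ℝ) * (if α = μ then ((((Lc ^ (j + 1) : ℕ) : ℝ) ^ (3 + 1 + 1))⁻¹) else 0) else 0 := by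
  rw [(hasSum_AN_inl_inr_sources R j x α μ).tsum_eq, axProjBmAt_const_apply _ (one_le_of_neZero (Lc ^ (j + 1)))]

end Uniform

end Summit.QuantumFields.BalabanUV.Beta.FP.TowerDoorUniformDataColumn

end
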